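import Summits.Ventures.YMGap.RobustBall.StringTensionOnBall
import Summits.Ventures.YMGap.RobustBall.AreaLawRowsSU3FreePair
import Summits.Ventures.YMGap.RobustBall.AreaLawRowsPair
import HarnessLib

/-!
# Venture YMGap, track Y2 ROBUST-BALL — `SU(3)` STRING TENSION ON THE BALL: the infinite-volume reading of the `SU(3)` area-law rows
# (hypothesis-free Bakry–Émery-pair balls and the certified-pair balls), `d = 4`

HONEST FRAMING.  Venture file of the cell `pub-ymgap` (QuantumFields programme), seat engine-2 (g7).  Strong-coupling LATTICE statements only;
nothing about the continuum, a spectral mass gap, weak coupling, or Clay.  rb-p2's `suFundStringTension_ge_onBall` (tree: every `N`, input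
`AreaLawOnBall N 4 β ε₀ ε₁ r mv` BY NAME) turns each TORUS area-law row into a statement about every INFINITE-VOLUME LIMIT STATE `μ` of every
eventually-member family `𝓦` of the ball (`perturbedLimitPoints β 𝓦`, non-empty by compactness): ONE pair `(C, c)`, `c > 0`, with the tree's
`ℤ⁴` area law `HasAreaLawWith μ χ₃ C c` (`χ₃ = (1/3) Re tr`, rectangles in the `(0,1)` plane) and `c ≤ suFundStringTension 3 μ` WHENEVER the string
tension of `μ` exists (existence is NOT asserted: a generic member is not reflection positive).  This file records the `SU(3)` instances:
* HYPOTHESIS-FREE (class K): the Bakry–Émery-pair balls of `AreaLawRowsSU3FreePair` at `β_W = 1/8` (`(ε₀, ε₁) = (0.814, 0.407)`) and `β_W = 1/4`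
  (`(0.406, 0.203)`) — the first unconditional infinite-volume area-law-on-a-ball statements for `SU(3)` in the tree's `WilsonLoops` vocabulary;
* CONDITIONAL on the cell's certified pairs (classes «K × C(H1) × C-iv(H2)» on P11, «K × C(H1) × C⁻(H2′)» on P35; NOTHING asserted about
  H1 `OneLinkPoincareSUN 3 (3/5) (4/5)`, H2 `OneLinkVarianceBound 3 (11/30) (49/20)`, H2′ `OneLinkVarianceBound 3 (3/5) (17/5)`): the pair-door balls of
  `AreaLawRowsPair` at `β_W = 1/2` (`(0.46, 0.23)`), `11/20` (`(0.41, 0.205)`) on P11 and `β_W = 3/4` (`(0.128, 0.064)`) on P35.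
Every row holds for every range `r` and every vertical window `mv ≥ 1` of the ball.
-/

noncomputable section

open MeasureTheory Filter Topology
open Literature.MathematicalPhysics.QuantumLattice
open Literature.MathematicalPhysics.QuantumFieldTheory hiding ZdEdge Site
open Literature.Barriers.QuantumFields (suFundStringTension)
open Summit.QuantumFields.BalabanUV.InfraRed.StrongCouplingPoincareDoorSUN (OneLinkPoincareSUN)
open Summit.QuantumFields.BalabanUV.InfraRed.StrongCouplingVarianceDoorSUN (OneLinkVarianceBound)
open Summit.Ventures.YMGap.RobustBall
  (AreaLawOnBall ClusterDomainFR IsSlabLocal PerturbationFamily perturbedLimitPoints suFundStringTension_ge_onBall)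
open Summit.Ventures.YMGap.RobustBallPair (su3_hsRow4_1_2 su3_hsRow4_11_20 su3_hsRow4_3_4)

namespace Summit.Ventures.YMGap.RobustBallSU3

/-! ### 1. Hypothesis-free balls (Bakry–Émery pair through the pair door) -/

/-- **`SU(3)`, `d = 4`, `β_W = 1/4`, ball `(ε₀, ε₁) = (0.406, 0.203)`, HYPOTHESIS-FREE: string tension on the ball.**  One `c > 0` such that every
infinite-volume limit state `μ` of every eventually-member family satisfies the `ℤ⁴` area law `HasAreaLawWith μ χ₃ C c` and, whenever its string
tension exists, `c ≤ suFundStringTension 3 μ`.  Input: `su3_freePairRow4_1_4`. [folklore] -/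
theorem su3_stringTension_onBall_free_1_4 (r : ℕ) {mv : ℕ} (hmv : 1 ≤ mv) :
    ∃ C c : ℝ, 0 < c ∧ ∀ 𝓦 : PerturbationFamily 4 3,
      (∀ᶠ L : ℕ in atTop, 𝓦 L ∈ ClusterDomainFR (2 * (203 / 1000)) (203 / 1000) r ∧ IsSlabLocal mv (𝓦 L)) →
        ∀ μ ∈ perturbedLimitPoints ((1 / 4 : ℝ) / 3) 𝓦,
          HasAreaLawWith μ (fun g => normalisedCharacter 3 (fundamentalRep (Fin 3) g)) C c ∧
          ((∃ σ : ℝ, HasStringTension μ (fun g => normalisedCharacter 3 (fundamentalRep (Fin 3) g)) σ) →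
            c ≤ suFundStringTension 3 μ) :=
  suFundStringTension_ge_onBall (su3_freePairRow4_1_4 r hmv)

/-- **`SU(3)`, `d = 4`, `β_W = 1/8`, ball `(0.814, 0.407)`, HYPOTHESIS-FREE**: the same, from `su3_freePairRow4_1_8`. [folklore] -/
theorem su3_stringTension_onBall_free_1_8 (r : ℕ) {mv : ℕ} (hmv : 1 ≤ mv) :
    ∃ C c : ℝ, 0 < c ∧ ∀ 𝓦 : PerturbationFamily 4 3,
      (∀ᶠ L : ℕ in atTop, 𝓦 L ∈ ClusterDomainFR (2 * (407 / 1000)) (407 / 1000) r ∧ IsSlabLocal mv (𝓦 L)) →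
        ∀ μ ∈ perturbedLimitPoints ((1 / 8 : ℝ) / 3) 𝓦,
          HasAreaLawWith μ (fun g => normalisedCharacter 3 (fundamentalRep (Fin 3) g)) C c ∧
          ((∃ σ : ℝ, HasStringTension μ (fun g => normalisedCharacter 3 (fundamentalRep (Fin 3) g)) σ) →
            c ≤ suFundStringTension 3 μ) :=
  suFundStringTension_ge_onBall (su3_freePairRow4_1_8 r hmv)

/-- **`SU(3)`, `d = 4`, `β_W = 1/3`, ball `(0.138, 0.069)`, HYPOTHESIS-FREE**: from `su3_freePairRow4_1_3` (the last grid coupling inside the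
Bakry–Émery pair door). [folklore] -/
theorem su3_stringTension_onBall_free_1_3 (r : ℕ) {mv : ℕ} (hmv : 1 ≤ mv) :
    ∃ C c : ℝ, 0 < c ∧ ∀ 𝓦 : PerturbationFamily 4 3,
      (∀ᶠ L : ℕ in atTop, 𝓦 L ∈ ClusterDomainFR (2 * (69 / 1000)) (69 / 1000) r ∧ IsSlabLocal mv (𝓦 L)) →
        ∀ μ ∈ perturbedLimitPoints ((1 / 3 : ℝ) / 3) 𝓦,
          HasAreaLawWith μ (fun g => normalisedCharacter 3 (fundamentalRep (Fin 3) g)) C c ∧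
          ((∃ σ : ℝ, HasStringTension μ (fun g => normalisedCharacter 3 (fundamentalRep (Fin 3) g)) σ) →
            c ≤ suFundStringTension 3 μ) :=
  suFundStringTension_ge_onBall (su3_freePairRow4_1_3 r hmv)

/-! ### 2. Certified-pair balls (conditional on H1/H2 resp. H1/H2′, displayed by name) -/

/-- **`SU(3)`, `d = 4`, `β_W = 1/2`, ball `(0.46, 0.23)`, GIVEN H1, H2** (pair door on P11, `su3_hsRow4_1_2`): string tension on the ball — one `c > 0`
for every infinite-volume limit state of every eventually-member family (`ℤ⁴` area law; `c ≤ suFundStringTension 3 μ` whenever the string tension exists).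
[folklore] -/
theorem su3_stringTension_onBall_1_2_of_certificates (hP : OneLinkPoincareSUN 3 (3 / 5) (4 / 5))
    (hV : OneLinkVarianceBound 3 (11 / 30) (49 / 20)) (r : ℕ) {mv : ℕ} (hmv : 1 ≤ mv) :
    ∃ C c : ℝ, 0 < c ∧ ∀ 𝓦 : PerturbationFamily 4 3,
      (∀ᶠ L : ℕ in atTop, 𝓦 L ∈ ClusterDomainFR (2 * (23 / 100)) (23 / 100) r ∧ IsSlabLocal mv (𝓦 L)) →
        ∀ μ ∈ perturbedLimitPoints ((1 / 2 : ℝ) / 3) 𝓦,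
          HasAreaLawWith μ (fun g => normalisedCharacter 3 (fundamentalRep (Fin 3) g)) C c ∧
          ((∃ σ : ℝ, HasStringTension μ (fun g => normalisedCharacter 3 (fundamentalRep (Fin 3) g)) σ) →
            c ≤ suFundStringTension 3 μ) :=
  suFundStringTension_ge_onBall (su3_hsRow4_1_2 r hmv hP hV)

/-- **`SU(3)`, `d = 4`, `β_W = 11/20`, ball `(0.41, 0.205)`, GIVEN H1, H2** — the radius cap of P11 (`su3_hsRow4_11_20`). [folklore] -/
theorem su3_stringTension_onBall_11_20_of_certificates (hP : OneLinkPoincareSUN 3 (3 / 5) (4 / 5))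
    (hV : OneLinkVarianceBound 3 (11 / 30) (49 / 20)) (r : ℕ) {mv : ℕ} (hmv : 1 ≤ mv) :
    ∃ C c : ℝ, 0 < c ∧ ∀ 𝓦 : PerturbationFamily 4 3,
      (∀ᶠ L : ℕ in atTop, 𝓦 L ∈ ClusterDomainFR (2 * (41 / 200)) (41 / 200) r ∧ IsSlabLocal mv (𝓦 L)) →
        ∀ μ ∈ perturbedLimitPoints ((11 / 20 : ℝ) / 3) 𝓦,
          HasAreaLawWith μ (fun g => normalisedCharacter 3 (fundamentalRep (Fin 3) g)) C c ∧
          ((∃ σ : ℝ, HasStringTension μ (fun g => normalisedCharacter 3 (fundamentalRep (Fin 3) g)) σ) →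
            c ≤ suFundStringTension 3 μ) :=
  suFundStringTension_ge_onBall (su3_hsRow4_11_20 r hmv hP hV)

/-- **`SU(3)`, `d = 4`, `β_W = 3/4`, ball `(0.128, 0.064)`, GIVEN H1, H2′** (pair door on P35, `su3_hsRow4_3_4`; twice CNS25's printed `SU(3)` Wilson
area-law threshold `3/8`). [folklore] -/
theorem su3_stringTension_onBall_3_4_of_nineTenthsPair (hP : OneLinkPoincareSUN 3 (3 / 5) (4 / 5))
    (hV : OneLinkVarianceBound 3 (3 / 5) (17 / 5)) (r : ℕ) {mv : ℕ} (hmv : 1 ≤ mv) :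
    ∃ C c : ℝ, 0 < c ∧ ∀ 𝓦 : PerturbationFamily 4 3,
      (∀ᶠ L : ℕ in atTop, 𝓦 L ∈ ClusterDomainFR (2 * (8 / 125)) (8 / 125) r ∧ IsSlabLocal mv (𝓦 L)) →
        ∀ μ ∈ perturbedLimitPoints ((3 / 4 : ℝ) / 3) 𝓦,
          HasAreaLawWith μ (fun g => normalisedCharacter 3 (fundamentalRep (Fin 3) g)) C c ∧
          ((∃ σ : ℝ, HasStringTension μ (fun g => normalisedCharacter 3 (fundamentalRep (Fin 3) g)) σ) →
            c ≤ suFundStringTension 3 μ) :=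
  suFundStringTension_ge_onBall (su3_hsRow4_3_4 r hmv hP hV)

end Summit.Ventures.YMGap.RobustBallSU3

end
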